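import Summits.QuantumFields.BalabanUV.T4Continuum.Spine.NE5.TwoRunTorusWalkNumerics
import Summits.QuantumFields.BalabanUV.T4Continuum.Spine.NE5.TwoRunTorusNE5Windows

/-!
# Spine/NE5/TwoRunTorusNE5Scalars — the SCALAR side conditions of the minimal END (T39
# `TwoRunTorusNE5Records.ne5_of_records_symm_all_scales`) hold JOINTLY at every scale, with scale-independent letters,
# for ANY volume constant `a₅ > 0` (cell `pub-balaban-gaps`, seat `ne5` gen 12; located point (x13))

WHY.  T39 reads `T4OutputRate.NE5` BY NAME from per-scale per-term walk records + symmetry + non-walk data under ≈ 45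
REAL-NUMBER side conditions in three groups: (L) Lemma 3's and (2.39)–(2.41)'s numbers on the constants record `c`
(witness: r10's `B13Lemma3TorusNonvacuity.numerics_nonvacuous`, which FIXES the volume constant `a₅ = 0`, `Aabs = 1`);
(P) the p. 17 numerics in the records' letters (threshold form: T34 `TwoRunTorusWalkNumerics.numerics_of_thresholds`,
whose volume threshold is `2n_Λ + w₀ + n_N∕2 ≤ a₅`); (W) the windows (T38 `TwoRunTorusNE5Windows.windows_of_thresholds`).
The published forms of (L) and (P) are NOT jointly usable for a term with a row bond (`a₅ = 0` against `a₅ ≥ 2n_Λ`), and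
no JOINT witness of T39's scalar binders existed: the row's «numerics not vacuous» held per group only — located point
(x13) of `HOME/ne/NE5.md`.  The only letters shared by (L) and (P)+(W) are `a` (`hPa : a ≤ γ₂ r_P²`) and `a₅` (`hvol`).
THIS FILE, `scalars_of_rates`: for ANY `a ≥ 0`, ANY `a₅ > 0` and any rate chain `κ > κ_a > κ_b > κ′ > κ″ > 0`, every
scalar binder of T39 outside (L) holds SIMULTANEOUSLY at EVERY scale for explicit letters, stated VERBATIM
(`(𝒦 j Z t φ).m ↦ m_𝒦 ≤ m`, `|Λ| ↦ c_Λ ≤ n_Λ|Z|`, `|Λ ⊕ C₀| ↦ c_N ≤ n_N|Z|`, `(Z.1).card ↦ n_Z`).  The volume binder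
comes from the SMALLNESS of `ϑ`, `γ₂ + a₂₀`, `w₀` (each `∝ min(1,a₅)∕(n_Λ+n_N+1)`, `vol_of_small`), NOT from `a₅` large as in
T34's `vol_group` — so `a₅ = ½`, compatible with the tree's Lemma-3 witness, suffices (print absorbs the per-cube volume
constant into `κ` instead, [II] p. 21 «for κ sufficiently large»); in NE5's pencil currency the price is a constant
factor in the two-run rate (T38: `R_j = α_j(8(K+1)∕ϑ₀ + 2)`, `ϑ₀ ∝ ϑ`).  With a Lemma-3 witness exporting `a₅ > 0` the
minimal END's real-number side is inhabited at once, and its content is exactly its STRUCTURAL hypotheses.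

HONEST FRAMING.  Real-number bookkeeping over two LANDED threshold theorems (T34, T38); every letter is an explicit
real; nothing of Bałaban's is constructed or asserted (which values his operators produce is NODE O's (v)⁺ and rows
NE2∕NE3's two-run rate).  NE5 NOT PRINTED ∕ NOT PROVED; leaves 0∕12; (D4) 0∕1; spine 0∕9.  Rung (B)+1 on a FIXED finite
T⁴ — NOT continuum, NOT infinite volume, NOT mass gap, NOT Clay.  HONEST DEPENDENCY: continuum YM on T⁴ ⇐ BetaPertH ∧
nine spine estimates; BetaPertH ⇐ (D1) ∧ (D4) ∧ CAP+tail.  0 sorry, 0 `def`.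

Sources: [II] = T. Bałaban, CMP **116** (1988) [Balaban1988RG2Cluster] p. 7, p. 15, (2.16) p. 16, (2.20)–(2.26)
pp. 16–17, p. 20, p. 21; [B9] = CMP **99** (1985) [Balaban1985BackgroundPropagators] (3.108) p. 416; C. King, CMP **102**
(1986) [King1986] p. 665.  Nothing here is a claim about the Yang–Mills mass gap.
-/

noncomputable section

namespace Summit.QuantumFields.BalabanUV.T4Continuum.Spine.NE5.TwoRunTorusNE5Scalars

open Literature.MathematicalPhysics.QuantumFieldTheory.Balaban1983to89
open Literature.MathematicalPhysics.QuantumFieldTheory.Balaban1983to89.B13TermWalkData (WalkConsts)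
open Literature.MathematicalPhysics.QuantumFieldTheory.Balaban1983to89.B13TermWalkDataOneTorus (SmallTheta)
open Literature.MathematicalPhysics.QuantumFieldTheory.Balaban1983to89.B9SectDSup (inv_one_sub_le_two)
open Summit.QuantumFields.BalabanUV.T4Continuum.Spine.NE5.TwoRunTorusWalkNumerics
  (numerics_of_thresholds smallRe_of_thresholds theta_group)
open Summit.QuantumFields.BalabanUV.T4Continuum.Spine.NE5.TwoRunTorusNE5Windows (windows_of_thresholds)

/-! ## §1. Elementary letters -/

/-- `G∕D·x ≤ G` when `0 ≤ G`, `0 < D`, `x ≤ D`. [folklore] -/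
theorem div_mul_le_self {G D x : ℝ} (hG : 0 ≤ G) (hD : 0 < D) (hx : x ≤ D) : G / D * x ≤ G := by
  calc G / D * x ≤ G / D * D := mul_le_mul_of_nonneg_left hx (div_nonneg hG hD.le)
    _ = G := div_mul_cancel₀ G hD.ne'

/-- **Monotonicity of the `hθR1le` coefficient in the record's own fibre number** `m_𝒦 ≤ m`. [folklore] -/
theorem coeff_mono {KΓ KE KC P1a P1b c₂ c₃ mK m : ℝ} {ν : ℕ} (hKΓ : 0 ≤ KΓ) (hKE : 0 ≤ KE) (hKC : 0 ≤ KC)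
    (hP1a : 0 ≤ P1a) (hP1b : 0 ≤ P1b) (hc₂ : 0 ≤ c₂) (hc₃ : 0 ≤ c₃) (hmK : 0 ≤ mK) (hle : mK ≤ m) :
    P1a * P1b * (2 * KΓ * KC * KΓ + KΓ * (KC * (2 * KE) * (mK * c₂ ^ ν) * KC * (mK * c₃ ^ ν)) * KΓ
        + KΓ * KC * (2 * KΓ)) ≤
      P1a * P1b * (2 * KΓ * KC * KΓ + KΓ * (KC * (2 * KE) * (m * c₂ ^ ν) * KC * (m * c₃ ^ ν)) * KΓ
        + KΓ * KC * (2 * KΓ)) := by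
  have hm : 0 ≤ m := hmK.trans hle
  have h2 : mK * c₂ ^ ν ≤ m * c₂ ^ ν := mul_le_mul_of_nonneg_right hle (pow_nonneg hc₂ ν)
  have h3 : mK * c₃ ^ ν ≤ m * c₃ ^ ν := mul_le_mul_of_nonneg_right hle (pow_nonneg hc₃ ν)
  gcongr
set_option maxHeartbeats 400000 in
/-- **THE VOLUME BINDER `hvol` FROM SMALLNESS** (in place of T34's `vol_group`, which needs `a₅ ≥ 2n_Λ + w₀ + n_N∕2`):
with `K = n_Λ + n_N + 1`, if the (2.16)-letter `A = K̄_C P₄ ϑ P₅` has `8K·A ≤ t`, the Gaussian prefactor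
`X = 2ϑP₅ + γ₂ + a₂₀` has `X·8(c_E+1)(2+2c_E g)K ≤ 2t`, `w₂₀ ≤ w₀|Z|` with `16w₀ ≤ t`, and `0 ≤ t ≤ min(1, a₅)`, then
T39's volume binder holds for every term with `|Λ| ≤ n_Λ|Z|`, `|Λ ⊕ C₀| ≤ n_N|Z|`. [cite: Balaban1988RG2Cluster, (2.26) p.17, p.21] -/
theorem vol_of_small {A X cE g cΛ cN w₂₀ a₅ t nΛ nN w₀ nZ : ℝ} (hA0 : 0 ≤ A)
    (hA : A * (8 * (nΛ + nN + 1)) ≤ t) (hX0 : 0 ≤ X)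
    (hX : X * (8 * (cE + 1) * (2 + 2 * cE * g) * (nΛ + nN + 1)) ≤ 2 * t)
    (hcE : 0 ≤ cE) (hg : 0 ≤ g) (ht0 : 0 ≤ t) (ht1 : t ≤ 1) (hta : t ≤ a₅)
    (hnΛ : 0 ≤ nΛ) (hnN : 0 ≤ nN) (hnZ : 0 ≤ nZ)
    (hcΛ : cΛ ≤ nΛ * nZ) (hcN : cN ≤ nN * nZ) (hcΛ0 : 0 ≤ cΛ)
    (hw₀ : 16 * w₀ ≤ t) (hw₂₀ : w₂₀ ≤ w₀ * nZ) :
    2 * (A * (1 + (1 - A)⁻¹) / 2) * cΛ + w₂₀ + X * cE * cΛ + X * (1 + 2 * cE * g) * cN ≤ a₅ * nZ := by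
  have hK1 : 1 ≤ nΛ + nN + 1 := by linarith
  have hAK : A * (nΛ + nN + 1) ≤ t / 8 := by nlinarith [hA]
  have hA8 : A ≤ 1 / 8 := by nlinarith [hAK, hK1, hA0, ht1]
  have hinv : (1 - A)⁻¹ ≤ 2 := inv_one_sub_le_two (by linarith)
  have hinv0 : 0 ≤ (1 - A)⁻¹ := inv_nonneg.2 (by linarith)
  have hA3 : A * (1 + (1 - A)⁻¹) ≤ 3 * A := by nlinarith [hinv, hA0, hinv0]
  have h1a : 2 * (A * (1 + (1 - A)⁻¹) / 2) * cΛ ≤ 3 * A * cΛ := by nlinarith [hA3, hcΛ0]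
  have h1b : 3 * A * cΛ ≤ 3 * A * (nΛ * nZ) := mul_le_mul_of_nonneg_left hcΛ (by positivity)
  have hAn : A * nΛ ≤ t / 8 := by
    have : A * nΛ ≤ A * (nΛ + nN + 1) := mul_le_mul_of_nonneg_left (by linarith) hA0
    linarith
  have h1 : 2 * (A * (1 + (1 - A)⁻¹) / 2) * cΛ ≤ 3 * (t / 8) * nZ := by
    have e : 3 * A * (nΛ * nZ) = 3 * (A * nΛ) * nZ := by ring
    have h' : 3 * (A * nΛ) * nZ ≤ 3 * (t / 8) * nZ := mul_le_mul_of_nonneg_right (by linarith) hnZ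
    linarith [h1a, h1b]
  have h2 : w₂₀ ≤ t / 16 * nZ := by
    have : w₀ * nZ ≤ t / 16 * nZ := mul_le_mul_of_nonneg_right (by linarith) hnZ
    linarith
  have hD0 : 0 ≤ 1 + 2 * cE * g := by positivity
  have h3a : X * cE * cΛ ≤ X * cE * (nΛ * nZ) := mul_le_mul_of_nonneg_left hcΛ (mul_nonneg hX0 hcE)
  have h4a : X * (1 + 2 * cE * g) * cN ≤ X * (1 + 2 * cE * g) * (nN * nZ) :=
    mul_le_mul_of_nonneg_left hcN (mul_nonneg hX0 hD0)
  have hcg : 0 ≤ cE * g := mul_nonneg hcE hg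
  have hB1 : cE ≤ 2 * (cE + 1) * (2 + 2 * cE * g) := by nlinarith [hcg, hcE]
  have hB2 : 1 + 2 * cE * g ≤ 2 * (cE + 1) * (2 + 2 * cE * g) := by nlinarith [hcg, hcE]
  have hB : cE * nΛ + (1 + 2 * cE * g) * nN ≤ 2 * (cE + 1) * (2 + 2 * cE * g) * (nΛ + nN + 1) := by
    have e1 := mul_le_mul_of_nonneg_right hB1 hnΛ
    have e2 := mul_le_mul_of_nonneg_right hB2 hnN
    have e3 : 0 ≤ 2 * (cE + 1) * (2 + 2 * cE * g) := by positivity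
    nlinarith [e1, e2, e3]
  have hXB : X * (cE * nΛ + (1 + 2 * cE * g) * nN) ≤ t / 2 := by
    have e1 := mul_le_mul_of_nonneg_left hB hX0
    have e2 : X * (2 * (cE + 1) * (2 + 2 * cE * g) * (nΛ + nN + 1)) =
        X * (8 * (cE + 1) * (2 + 2 * cE * g) * (nΛ + nN + 1)) / 4 := by ring
    linarith [e1, e2, hX]
  have h34 : X * cE * cΛ + X * (1 + 2 * cE * g) * cN ≤ t / 2 * nZ := by
    have e : X * cE * (nΛ * nZ) + X * (1 + 2 * cE * g) * (nN * nZ) =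
        X * (cE * nΛ + (1 + 2 * cE * g) * nN) * nZ := by ring
    have e' := mul_le_mul_of_nonneg_right hXB hnZ
    linarith [h3a, h4a, e, e']
  have htot : (15 / 16 * t) * nZ ≤ a₅ * nZ := mul_le_mul_of_nonneg_right (by linarith) hnZ
  linarith [h1, h2, h34, htot]

/-! ## §2. The letters -/

/-- **THE NON-LEMMA-3 SCALAR BINDERS OF T39 HOLD JOINTLY AT EVERY SCALE.**  Data: majorant letters `K̄_Γ, K̄_E, K̄_C ≥ 0`,
drop `ε > 0`, torus walk rate `κ > 0` with any chain `κ > κ_a > κ_b > κ′ > κ″ > 0` (e.g. `4κ∕5 > 3κ∕5 > 2κ∕5 > κ∕5`),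
fibre bound `m ≥ 0`, `ν`, the pencil's rate `θ` and margin `s`, the σ-distance floor `R_σ0`, per-cube size ratios
`n_Λ, n_N ≥ 0`, and the two letters shared with Lemma 3's group: `a ≥ 0` (read by `hPa`) and the volume constant
`a₅ > 0` (read by `hvol`).  Conclusion: packages `w j`, sizes `α j` (T38) and letters `ϑ, c_E, g, γ₂, a₂₀, w₀, r_P`
such that at EVERY scale `j` T39's binders hold verbatim: `hw hα1 hαs hsm hκa`; the letters of `w j` EQUAL the given
ones; `hθR1le` for every `0 ≤ m_𝒦 ≤ m`; `hsmallKθ`; `hcE hgE hsmallRe`; `0 < γ₂`, `0 ≤ a₂₀`, `hαc`, `hsmall`, `hPa`;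
`0 < w₀` and `hvol` for every `|Λ| ≤ n_Λ|Z|`, `|Λ ⊕ C₀| ≤ n_N|Z|`, `w₂₀ ≤ w₀|Z|`.  (Witness: `c_E = K̄_C P₀`,
`g = c_E(K̄_Γ P₀)²`, `P₀ = m(1+2∕κ)^ν`; `t = min 1 a₅`; `γ₂ = a₂₀ = t∕2D`, `D = 8(c_E+1)(2+2c_E g)(n_Λ+n_N+1)`;
`ϑ = (t∕D)∕(4(P₅+1)(K̄_C P₄+1)(P₀+1))`; `w₀ = t∕16`; `r_P = a∕γ₂ + 1`; windows by T38 at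
`ϑ₀ = 4(max K̄_Γ K̄_E + 1)·ϑ∕(2K̄_Γ + 2K̄_E + Q(m) + 1)`, `Q` the `hθR1le` coefficient; the p. 17 group by T34.)
[cite: Balaban1988RG2Cluster, p.7, p.15, (2.16) p.16, (2.20)–(2.26) pp.16–17, p.20, p.21; Balaban1985BackgroundPropagators, (3.108) p.416; King1986, p.665] -/
theorem scalars_of_rates {KΓ KE KC ε κ : ℝ} (θ s Rσ₀ : ℝ) (hKΓ : 0 ≤ KΓ) (hKE : 0 ≤ KE) (hKC : 0 ≤ KC)
    (hε : 0 < ε) (hκ : 0 < κ) {m : ℝ} (hm : 0 ≤ m) (ν : ℕ)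
    {κa κb kap' kap'' : ℝ} (hκa : κa < κ) (hκb : κb < κa) (h2 : kap' < κb) (h1 : kap'' < kap')
    (hkap'' : 0 < kap'') {nΛ nN : ℝ} (hnΛ : 0 ≤ nΛ) (hnN : 0 ≤ nN) {a a₅ : ℝ} (ha : 0 ≤ a) (ha₅ : 0 < a₅) :
    ∃ (w : ℕ → WalkConsts) (α : ℕ → ℝ) (ϑ cE g γ₂ a₂₀ w₀ rP : ℝ),
      -- (W) the windows (T38)
      (∀ j, (w j).Admissible (α j) Rσ₀) ∧ (∀ j, 1 < α j) ∧ (∀ j, θ ^ j < s → s / θ ^ j ≤ α j) ∧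
      (∀ j, SmallTheta (w j) (α j) ϑ) ∧ (∀ j, κa < (w j).kap) ∧
      (∀ j, (w j).KbarΓ = KΓ ∧ (w j).KbarE = KE ∧ (w j).KbarC = KC ∧ (w j).kap = κ ∧ (w j).ε = ε) ∧
      0 < ϑ ∧ 0 ≤ cE ∧ 0 ≤ g ∧
      -- (P) `hθR1le`, for every record fibre number `m_𝒦 ≤ m`
      (∀ j, ∀ mK : ℝ, 0 ≤ mK → mK ≤ m →
        (m * (1 + 2 / (κb - kap')) ^ ν) * (m * (1 + 2 / (kap' - kap'')) ^ ν)
          * ((2 * (w j).KbarΓ * Real.exp (-((w j).ε * (w j).Rσ)) + 2 * (w j).KbarΓ * α j / (w j).R) * (w j).KbarC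
              * (w j).KbarΓ
            + (w j).KbarΓ * ((w j).KbarC * (2 * (w j).KbarE * Real.exp (-((w j).ε * (w j).Rσ))
                + 2 * (w j).KbarE * α j / (w j).R)
                * (mK * (1 + 2 / ((w j).kap - κa)) ^ ν) * (w j).KbarC
                * (mK * (1 + 2 / (κa - κb)) ^ ν)) * (w j).KbarΓ
            + (w j).KbarΓ * (w j).KbarC * (2 * (w j).KbarΓ * Real.exp (-((w j).ε * (w j).Rσ))
                + 2 * (w j).KbarΓ * α j / (w j).R)) ≤ ϑ) ∧
      -- `hsmallKθ`
      (∀ j, (w j).KbarC * (m * (1 + 2 / κb) ^ ν) * (ϑ * (m * (1 + 2 / kap'') ^ ν)) < 1) ∧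
      -- the envelopes `hcE`, `hgE` and NODE A's positivity smallness `hsmallRe`
      (∀ j, (w j).KbarC * (m * (1 + 2 / (w j).kap) ^ ν) ≤ cE) ∧
      (∀ j, cE * ((w j).KbarΓ * (m * (1 + 2 / (w j).kap) ^ ν)) ^ 2 ≤ g) ∧
      (∀ j, (2 * (w j).KbarE * Real.exp (-((w j).ε * (w j).Rσ)) + 2 * (w j).KbarE * α j / (w j).R)
        * (m * (1 + 2 / (w j).kap) ^ ν) * cE < 1) ∧
      -- the (2.20)∕(2.22) constants: `hγ₂`, `ha0`, `hαc`, `hsmall`, `hPa`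
      0 < γ₂ ∧ 0 ≤ a₂₀ ∧
      (2 * (ϑ * (m * (1 + 2 / kap'') ^ ν)) + (γ₂ + a₂₀)) * cE ≤ 1 / 2 ∧
      (2 * (ϑ * (m * (1 + 2 / kap'') ^ ν)) + (γ₂ + a₂₀)) * (1 + 2 * cE * g) ≤ 1 / 2 ∧
      a ≤ γ₂ * rP ^ 2 ∧
      -- `hvol` for every term with `|Λ| ≤ n_Λ|Z|`, `|Λ ⊕ C₀| ≤ n_N|Z|`, and every (2.20)-constant `w₂₀ ≤ w₀|Z|`
      0 < w₀ ∧
      (∀ j, ∀ cΛ cN nZ w₂₀ : ℝ, 0 ≤ nZ → 0 ≤ cΛ → 0 ≤ cN → cΛ ≤ nΛ * nZ → cN ≤ nN * nZ → w₂₀ ≤ w₀ * nZ →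
        2 * ((w j).KbarC * (m * (1 + 2 / κb) ^ ν) * (ϑ * (m * (1 + 2 / kap'') ^ ν))
              * (1 + (1 - (w j).KbarC * (m * (1 + 2 / κb) ^ ν) * (ϑ * (m * (1 + 2 / kap'') ^ ν)))⁻¹) / 2)
            * cΛ
          + w₂₀ + (2 * (ϑ * (m * (1 + 2 / kap'') ^ ν)) + (γ₂ + a₂₀)) * cE * cΛ
          + (2 * (ϑ * (m * (1 + 2 / kap'') ^ ν)) + (γ₂ + a₂₀)) * (1 + 2 * cE * g) * cN ≤ a₅ * nZ) := by
  have hgb : 0 < κb - kap' := sub_pos.2 h2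
  have hg1 : 0 < kap' - kap'' := sub_pos.2 h1
  have hga : 0 < κ - κa := sub_pos.2 hκa
  have hgab : 0 < κa - κb := sub_pos.2 hκb
  have hκb0 : 0 < κb := hkap''.trans (h1.trans h2)
  have hP₀ : 0 ≤ m * (1 + 2 / κ) ^ ν := by positivity
  have hP₄ : 0 ≤ m * (1 + 2 / κb) ^ ν := by positivity
  have hP₅ : 0 ≤ m * (1 + 2 / kap'') ^ ν := by positivity
  have hP1a : 0 ≤ m * (1 + 2 / (κb - kap')) ^ ν := by positivity
  have hP1b : 0 ≤ m * (1 + 2 / (kap' - kap'')) ^ ν := by positivity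
  have hc₂ : 0 ≤ 1 + 2 / (κ - κa) := by positivity
  have hc₃ : 0 ≤ 1 + 2 / (κa - κb) := by positivity
  -- the envelopes, the small unit `t = min 1 a₅` and the (2.20)∕(2.22) threshold `G = t∕D`
  set cE : ℝ := KC * (m * (1 + 2 / κ) ^ ν) with hcEdef
  clear_value cE
  have hcE : 0 ≤ cE := by rw [hcEdef]; exact mul_nonneg hKC hP₀
  set g : ℝ := cE * (KΓ * (m * (1 + 2 / κ) ^ ν)) ^ 2 with hgdef
  clear_value g
  have hg : 0 ≤ g := by rw [hgdef]; positivity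
  set t : ℝ := min 1 a₅ with htdef
  have ht0 : 0 < t := by rw [htdef]; exact lt_min one_pos ha₅
  have ht1 : t ≤ 1 := by rw [htdef]; exact min_le_left _ _
  have hta : t ≤ a₅ := by rw [htdef]; exact min_le_right _ _
  clear_value t
  set D : ℝ := 8 * (cE + 1) * (2 + 2 * cE * g) * (nΛ + nN + 1) with hDdef
  clear_value D
  have hcg : 0 ≤ cE * g := mul_nonneg hcE hg
  have hK1 : (1 : ℝ) ≤ nΛ + nN + 1 := by linarith only [hnΛ, hnN]
  have hE1 : 2 * (cE + 1) ≤ (cE + 1) * (2 + 2 * cE * g) := by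
    have h0 : 0 ≤ (cE + 1) * (2 * cE * g) := mul_nonneg (by linarith only [hcE]) (by linarith only [hcg])
    have e : (cE + 1) * (2 + 2 * cE * g) = 2 * (cE + 1) + (cE + 1) * (2 * cE * g) := by ring
    rw [e]; linarith only [h0]
  have hE2 : 2 + 2 * cE * g ≤ (cE + 1) * (2 + 2 * cE * g) := by
    have h0 : 0 ≤ cE * (2 + 2 * cE * g) := mul_nonneg hcE (by linarith only [hcg])
    have e : (cE + 1) * (2 + 2 * cE * g) = (2 + 2 * cE * g) + cE * (2 + 2 * cE * g) := by ring
    rw [e]; linarith only [h0]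
  have hPi0 : 0 ≤ (cE + 1) * (2 + 2 * cE * g) := by positivity
  have hPi1 := hE1.trans (le_mul_of_one_le_right hPi0 hK1)
  have hPi2 := hE2.trans (le_mul_of_one_le_right hPi0 hK1)
  have hPi3 : 2 * (nΛ + nN + 1) ≤ (cE + 1) * (2 + 2 * cE * g) * (nΛ + nN + 1) :=
    mul_le_mul_of_nonneg_right (by linarith only [hE1, hcE]) (by linarith only [hnΛ, hnN])
  have hDeq : D = 8 * ((cE + 1) * (2 + 2 * cE * g) * (nΛ + nN + 1)) := by rw [hDdef]; ring
  have hDK : 16 * (nΛ + nN + 1) ≤ D := by rw [hDeq]; linarith only [hPi3]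
  have hD : 0 < D := by linarith only [hDK, hK1]
  set G : ℝ := t / D with hGdef
  clear_value G
  have hG0 : 0 < G := by rw [hGdef]; exact div_pos ht0 hD
  have hG16 : G * (16 * (nΛ + nN + 1)) ≤ t := by rw [hGdef]; exact div_mul_le_self ht0.le hD hDK
  have hGD : G * D = t := by rw [hGdef]; exact div_mul_cancel₀ t hD.ne'
  have hGc : 4 * G * cE ≤ 1 := by
    have h := div_mul_le_self ht0.le hD (by rw [hDeq]; linarith only [hPi1, hcE] : 4 * cE ≤ D)
    have e : 4 * G * cE = t / D * (4 * cE) := by rw [hGdef]; ring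
    linarith only [h, e, ht1]
  have hGc' : G * cE ≤ 1 / 4 := by
    have e : 4 * G * cE = 4 * (G * cE) := by ring
    linarith only [hGc, e]
  have hGg : 4 * G * (1 + 2 * cE * g) ≤ 1 := by
    have h := div_mul_le_self ht0.le hD (by rw [hDeq]; linarith only [hPi2, hcg] : 4 * (1 + 2 * cE * g) ≤ D)
    have e : 4 * G * (1 + 2 * cE * g) = t / D * (4 * (1 + 2 * cE * g)) := by rw [hGdef]; ring
    linarith only [h, e, ht1]
  clear hE1 hE2 hPi0 hPi1 hPi2 hPi3
  -- NODE A's smallness `ϑ = G∕Dϑ`, `Dϑ = 4·(P₅+1)·(K̄_C P₄+1)·(P₀+1)`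
  set Dϑ : ℝ := 4 * ((m * (1 + 2 / kap'') ^ ν) + 1) * (KC * (m * (1 + 2 / κb) ^ ν) + 1)
    * ((m * (1 + 2 / κ) ^ ν) + 1) with hDϑdef
  clear_value Dϑ
  have hKP4 : 0 ≤ KC * (m * (1 + 2 / κb) ^ ν) := mul_nonneg hKC hP₄
  have hKP45 : 0 ≤ KC * (m * (1 + 2 / κb) ^ ν) * (m * (1 + 2 / kap'') ^ ν) := mul_nonneg hKP4 hP₅
  have hY1 : (1 : ℝ) ≤ KC * (m * (1 + 2 / κb) ^ ν) + 1 := by linarith only [hKP4]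
  have hXY1 : (1 : ℝ) ≤ ((m * (1 + 2 / kap'') ^ ν) + 1) * (KC * (m * (1 + 2 / κb) ^ ν) + 1) :=
    one_le_mul_of_one_le_of_one_le (by linarith only [hP₅]) hY1
  have hXYZ : ((m * (1 + 2 / kap'') ^ ν) + 1) * (KC * (m * (1 + 2 / κb) ^ ν) + 1) ≤
      ((m * (1 + 2 / kap'') ^ ν) + 1) * (KC * (m * (1 + 2 / κb) ^ ν) + 1) * ((m * (1 + 2 / κ) ^ ν) + 1) :=
    le_mul_of_one_le_right (zero_le_one.trans hXY1) (by linarith only [hP₀])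
  have hXle : (m * (1 + 2 / kap'') ^ ν) + 1 ≤
      ((m * (1 + 2 / kap'') ^ ν) + 1) * (KC * (m * (1 + 2 / κb) ^ ν) + 1) * ((m * (1 + 2 / κ) ^ ν) + 1) :=
    (le_mul_of_one_le_right (by linarith only [hP₅]) hY1).trans hXYZ
  have hZle : (m * (1 + 2 / κ) ^ ν) + 1 ≤
      ((m * (1 + 2 / kap'') ^ ν) + 1) * (KC * (m * (1 + 2 / κb) ^ ν) + 1) * ((m * (1 + 2 / κ) ^ ν) + 1) :=
    le_mul_of_one_le_left (by linarith only [hP₀]) hXY1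
  have hb : KC * (m * (1 + 2 / κb) ^ ν) * (m * (1 + 2 / kap'') ^ ν) + 1 ≤
      ((m * (1 + 2 / kap'') ^ ν) + 1) * (KC * (m * (1 + 2 / κb) ^ ν) + 1) := by
    have e : ((m * (1 + 2 / kap'') ^ ν) + 1) * (KC * (m * (1 + 2 / κb) ^ ν) + 1) =
        KC * (m * (1 + 2 / κb) ^ ν) * (m * (1 + 2 / kap'') ^ ν) + 1
          + ((m * (1 + 2 / kap'') ^ ν) + KC * (m * (1 + 2 / κb) ^ ν)) := by ring
    rw [e]; linarith only [hKP4, hP₅]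
  have hDϑeq : Dϑ = 4 * (((m * (1 + 2 / kap'') ^ ν) + 1) * (KC * (m * (1 + 2 / κb) ^ ν) + 1)
      * ((m * (1 + 2 / κ) ^ ν) + 1)) := by rw [hDϑdef]; ring
  have hDϑ : 0 < Dϑ := by rw [hDϑeq]; linarith only [hXY1, hXYZ]
  set ϑ : ℝ := G / Dϑ with hϑdef
  clear_value ϑ
  have hϑ0 : 0 < ϑ := by rw [hϑdef]; exact div_pos hG0 hDϑ
  -- the θ-thresholds of T34, `ϑP₀ ≤ G∕4` (for `hsmallRe`) and `A = K̄_C P₄ ϑ P₅ ≤ G∕4` (for `hvol`)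
  have hθG : 2 * ϑ * (m * (1 + 2 / kap'') ^ ν) ≤ G := by
    have h' := div_mul_le_self hG0.le hDϑ (by rw [hDϑeq]; linarith only [hXle, hP₅] :
      2 * (m * (1 + 2 / kap'') ^ ν) ≤ Dϑ)
    have e : 2 * ϑ * (m * (1 + 2 / kap'') ^ ν) = G / Dϑ * (2 * (m * (1 + 2 / kap'') ^ ν)) := by rw [hϑdef]; ring
    linarith only [h', e]
  have hθK : 2 * ϑ * (KC * (m * (1 + 2 / κb) ^ ν) * (m * (1 + 2 / kap'') ^ ν) + 1) ≤ 1 := by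
    have h' := div_mul_le_self hG0.le hDϑ (by rw [hDϑeq]; linarith only [hb, hXYZ, hKP45] :
      2 * (KC * (m * (1 + 2 / κb) ^ ν) * (m * (1 + 2 / kap'') ^ ν) + 1) ≤ Dϑ)
    have e : 2 * ϑ * (KC * (m * (1 + 2 / κb) ^ ν) * (m * (1 + 2 / kap'') ^ ν) + 1) =
        G / Dϑ * (2 * (KC * (m * (1 + 2 / κb) ^ ν) * (m * (1 + 2 / kap'') ^ ν) + 1)) := by rw [hϑdef]; ring
    have hG1 : G ≤ 1 := by
      have h16 : G * 16 ≤ G * (16 * (nΛ + nN + 1)) := mul_le_mul_of_nonneg_left (by linarith only [hK1]) hG0.le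
      linarith only [h16, hG16, ht1]
    linarith only [h', e, hG1]
  have hϑP₀ : ϑ * (m * (1 + 2 / κ) ^ ν) ≤ G / 4 := by
    have h' := div_mul_le_self hG0.le hDϑ (by rw [hDϑeq]; linarith only [hZle] : 4 * (m * (1 + 2 / κ) ^ ν) ≤ Dϑ)
    have e : 4 * (ϑ * (m * (1 + 2 / κ) ^ ν)) = G / Dϑ * (4 * (m * (1 + 2 / κ) ^ ν)) := by rw [hϑdef]; ring
    linarith only [h', e]
  have hAG : KC * (m * (1 + 2 / κb) ^ ν) * (ϑ * (m * (1 + 2 / kap'') ^ ν)) ≤ G / 4 := by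
    have h' := div_mul_le_self hG0.le hDϑ (by rw [hDϑeq]; linarith only [hb, hXYZ] :
      4 * (KC * (m * (1 + 2 / κb) ^ ν) * (m * (1 + 2 / kap'') ^ ν)) ≤ Dϑ)
    have e : 4 * (KC * (m * (1 + 2 / κb) ^ ν) * (ϑ * (m * (1 + 2 / kap'') ^ ν))) =
        G / Dϑ * (4 * (KC * (m * (1 + 2 / κb) ^ ν) * (m * (1 + 2 / kap'') ^ ν))) := by rw [hϑdef]; ring
    linarith only [h', e]
  have hA0 : 0 ≤ KC * (m * (1 + 2 / κb) ^ ν) * (ϑ * (m * (1 + 2 / kap'') ^ ν)) := by positivity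
  clear hY1 hXY1 hXYZ hXle hZle hb hDϑeq
  have hGsum : G / 2 + G / 2 ≤ G := (add_halves G).le
  have hθgrp := theta_group (KC := KC) (P4 := m * (1 + 2 / κb) ^ ν) (P5 := m * (1 + 2 / kap'') ^ ν) (θ := ϑ)
    (G := G) (γ₂ := G / 2) (a₂₀ := G / 2) (cE := cE) (g := g) hKC hP₄ hP₅ hϑ0.le hcE hg (half_pos hG0).le
    (half_pos hG0).le hGsum hGc hGg hθG hθK
  -- the `hθR1le` coefficient at `m_𝒦 = m` and the decay ∕ reach budget `ϑ∕S` handed to T38 as `ϑ₀`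
  set Qm : ℝ := (m * (1 + 2 / (κb - kap')) ^ ν) * (m * (1 + 2 / (kap' - kap'')) ^ ν) *
      (2 * KΓ * KC * KΓ + KΓ * (KC * (2 * KE) * (m * (1 + 2 / (κ - κa)) ^ ν) * KC
        * (m * (1 + 2 / (κa - κb)) ^ ν)) * KΓ + KΓ * KC * (2 * KΓ)) with hQmdef
  clear_value Qm
  have hQm : 0 ≤ Qm := by rw [hQmdef]; positivity
  set S : ℝ := 2 * KΓ + 2 * KE + Qm + 1 with hSdef
  clear_value S
  have hS : 0 < S := by rw [hSdef]; positivity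
  have hK1' : 0 < max KΓ KE + 1 := by
    have h0 : 0 ≤ max KΓ KE := hKΓ.trans (le_max_left _ _)
    linarith only [h0]
  have hϑ₀ : 0 < 4 * (max KΓ KE + 1) * (ϑ / S) := by positivity
  obtain ⟨w, α, hw, hα1, hαs, -, hlett, -, hd⟩ := windows_of_thresholds θ s Rσ₀ hKΓ hKE hKC hε hκ hϑ₀
  have hdS : ∀ j, Real.exp (-((w j).ε * (w j).Rσ)) + α j / (w j).R ≤ ϑ / S := fun j =>
    (hd j).trans_eq (mul_div_cancel_left₀ (ϑ / S) (mul_pos four_pos hK1').ne')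
  have hRj : ∀ j, 0 < (w j).R := fun j => (zero_lt_one.trans (hα1 j)).trans (hw j).hαR
  have hαj : ∀ j, 0 ≤ α j := fun j => (zero_lt_one.trans (hα1 j)).le
  have hKΓw : ∀ j, 0 ≤ (w j).KbarΓ := fun j => (hlett j).1.symm ▸ hKΓ
  have hKEw : ∀ j, 0 ≤ (w j).KbarE := fun j => (hlett j).2.1.symm ▸ hKE
  have hKCw : ∀ j, 0 ≤ (w j).KbarC := fun j => (hlett j).2.2.1.symm ▸ hKC
  have hκaw : ∀ j, κa < (w j).kap := fun j => (hlett j).2.2.2.1.symm ▸ hκa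
  have hθKw : ∀ j, 2 * ϑ * ((w j).KbarC * (m * (1 + 2 / κb) ^ ν) * (m * (1 + 2 / kap'') ^ ν) + 1) ≤ 1 :=
    fun j => by rw [(hlett j).2.2.1]; exact hθK
  -- T34's threshold (3) per scale and record fibre number, from T38's decay ∕ reach bound and `coeff_mono`
  have hs : ∀ j (mK : ℝ), 0 ≤ mK → mK ≤ m → (Real.exp (-((w j).ε * (w j).Rσ)) + α j / (w j).R) *
      (2 * (w j).KbarΓ + 2 * (w j).KbarE +
        (m * (1 + 2 / (κb - kap')) ^ ν) * (m * (1 + 2 / (kap' - kap'')) ^ ν) *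
          (2 * (w j).KbarΓ * (w j).KbarC * (w j).KbarΓ
            + (w j).KbarΓ * ((w j).KbarC * (2 * (w j).KbarE) * (mK * (1 + 2 / ((w j).kap - κa)) ^ ν)
                * (w j).KbarC * (mK * (1 + 2 / (κa - κb)) ^ ν)) * (w j).KbarΓ
            + (w j).KbarΓ * (w j).KbarC * (2 * (w j).KbarΓ))) ≤ ϑ := by
    intro j mK hmK hmKm
    obtain ⟨hKΓj, hKEj, hKCj, hkapj, -⟩ := hlett j
    have hd0 : 0 ≤ Real.exp (-((w j).ε * (w j).Rσ)) + α j / (w j).R := by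
      have := hRj j; have := hαj j; positivity
    rw [hKΓj, hKEj, hKCj, hkapj]
    have hmono := coeff_mono (ν := ν) hKΓ hKE hKC hP1a hP1b hc₂ hc₃ hmK hmKm
    have hle : 2 * KΓ + 2 * KE +
        (m * (1 + 2 / (κb - kap')) ^ ν) * (m * (1 + 2 / (kap' - kap'')) ^ ν) *
          (2 * KΓ * KC * KΓ + KΓ * (KC * (2 * KE) * (mK * (1 + 2 / (κ - κa)) ^ ν) * KC
            * (mK * (1 + 2 / (κa - κb)) ^ ν)) * KΓ + KΓ * KC * (2 * KΓ)) ≤ S := by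
      rw [hSdef, hQmdef]; linarith only [hmono]
    calc _ ≤ (Real.exp (-((w j).ε * (w j).Rσ)) + α j / (w j).R) * S := mul_le_mul_of_nonneg_left hle hd0
      _ ≤ ϑ / S * S := mul_le_mul_of_nonneg_right (hdS j) hS.le
      _ = ϑ := div_mul_cancel₀ ϑ hS.ne'
  -- T34 per scale and record fibre number (its volume slot fed trivially; `hvol` comes from `vol_of_small` instead)
  have key := fun (j : ℕ) (mK : ℝ) (hmK : 0 ≤ mK) (hmKm : mK ≤ m) =>
    numerics_of_thresholds (w j) (hKΓw j) (hKEw j) (hKCw j) (hαj j) (hRj j) hm hmK (ν := ν) (hκaw j) hκb h2 h1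
      hkap'' (θ := ϑ) (G := G) (γ₂ := G / 2) (a₂₀ := G / 2) (w₂₀ := 0) (cE := cE) (g := g) (a₅ := 0) (nΛ := 0)
      (nN := 0) (w₀ := 0) (nZ := 0) (cΛ := 0) (cN := 0) hcE hg (half_pos hG0).le (half_pos hG0).le hϑ0.le le_rfl
      hGsum hGc hGg hθG (hθKw j) (hs j mK hmK hmKm) (by simp) (by simp) le_rfl le_rfl (by simp) (by norm_num)
  refine ⟨w, α, ϑ, cE, g, G / 2, G / 2, t / 16, a / (G / 2) + 1, hw, hα1, hαs, fun j => (key j 0 le_rfl hm).1,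
    hκaw, hlett, hϑ0, hcE, hg, fun j mK hmK hmKm => (key j mK hmK hmKm).2.1, fun j => (key j 0 le_rfl hm).2.2.1,
    fun j => ?_, fun j => ?_, fun j => ?_, half_pos hG0, (half_pos hG0).le, hθgrp.2.1, hθgrp.2.2.1, ?_,
    by positivity, fun j cΛ cN nZ w₂₀ hnZ hcΛ0 hcN0 hcΛ hcN hw₂₀ => ?_⟩
  · -- hcE
    rw [(hlett j).2.2.1, (hlett j).2.2.2.1, hcEdef]
  · -- hgE
    rw [(hlett j).1, (hlett j).2.2.2.1, hgdef]
  · -- hsmallRe (T34's `smallRe_of_thresholds`, NODE A's letter from `SmallTheta`, and `2ϑ(P₀c_E) ≤ 1`)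
    obtain ⟨-, hKEj, -, hkapj, -⟩ := hlett j
    have hθRe : 2 * ϑ * ((m * (1 + 2 / (w j).kap) ^ ν) * cE) ≤ 1 := by
      rw [hkapj]
      have f := mul_le_mul_of_nonneg_right hϑP₀ hcE
      have e1 : 2 * ϑ * ((m * (1 + 2 / κ) ^ ν) * cE) = 2 * (ϑ * (m * (1 + 2 / κ) ^ ν) * cE) := by ring
      have e2 : G / 4 * cE = 1 / 4 * (G * cE) := by ring
      linarith only [f, e1, e2, hGc']
    exact smallRe_of_thresholds (w j) (hKEj.symm ▸ hKE) (hαj j) (hRj j) hm (hkapj.symm ▸ hκ) hcE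
      (key j 0 le_rfl hm).1.hE hθRe
  · -- hPa : a ≤ γ₂ r_P² with r_P = a∕γ₂ + 1 ≥ 1
    have hγ : 0 < G / 2 := half_pos hG0
    have hr1 : 1 ≤ a / (G / 2) + 1 := by
      have h0 : 0 ≤ a / (G / 2) := div_nonneg ha hγ.le
      linarith only [h0]
    have hGne : G ≠ 0 := hG0.ne'
    have e : G / 2 * (a / (G / 2) + 1) = a + G / 2 := by field_simp
    calc a ≤ a + G / 2 := by linarith only [hG0]
      _ = G / 2 * (a / (G / 2) + 1) := e.symm
      _ ≤ G / 2 * (a / (G / 2) + 1) ^ 2 := mul_le_mul_of_nonneg_left (le_self_pow₀ hr1 two_ne_zero) hγ.le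
  · -- hvol from smallness
    rw [(hlett j).2.2.1]
    have hX0 : 0 ≤ 2 * (ϑ * (m * (1 + 2 / kap'') ^ ν)) + (G / 2 + G / 2) := by positivity
    refine vol_of_small hA0 ?_ hX0 ?_ hcE hg ht0.le ht1 hta hnΛ hnN hnZ hcΛ hcN hcΛ0 (le_of_eq (by ring)) hw₂₀
    · -- `8K·A ≤ t`: `A ≤ G∕4` and `G·16K ≤ t`
      have f := mul_le_mul_of_nonneg_right hAG (by linarith only [hnΛ, hnN] : (0 : ℝ) ≤ 8 * (nΛ + nN + 1))
      have e1 : G / 4 * (8 * (nΛ + nN + 1)) = 1 / 8 * (G * (16 * (nΛ + nN + 1))) := by ring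
      linarith only [f, e1, hG16, ht0]
    · -- `X·D ≤ 2t`: `X ≤ 2G` and `G·D = t`
      have hX2G : 2 * (ϑ * (m * (1 + 2 / kap'') ^ ν)) + (G / 2 + G / 2) ≤ 2 * G := by
        have e : 2 * (ϑ * (m * (1 + 2 / kap'') ^ ν)) = 2 * ϑ * (m * (1 + 2 / kap'') ^ ν) := by ring
        linarith only [hθG, e]
      have h := mul_le_mul_of_nonneg_right hX2G hD.le
      have e2 : 2 * G * D = 2 * t := by rw [mul_assoc, hGD]
      rw [hDdef] at h e2
      linarith only [h, e2]

end Summit.QuantumFields.BalabanUV.T4Continuum.Spine.NE5.TwoRunTorusNE5Scalars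

end
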